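import Literature.NumberTheory.GaloisRepresentations.IdeleProjectionS
import Literature.NumberTheory.GaloisRepresentations.GalLayerSystemSES
import Literature.Algebra.Homology.DiscreteRepInflationQuotient
import HarnessLib

/-!
# Reading a `G_S`-morphism `f : X ⟶ I_S` through door-c6's `Γ_K`-readout: the inflated morphism
# `f♯ : Inf X ⟶ J̄` (Harari, *Galois Cohomology and CFT*, Prop. 17.26; Milne ADT I Lemma 4.13)

Topic `NumberTheory/GaloisRepresentations`; namespace `Literature.NumberTheory.GaloisRepresentations.IdeleClassBar`; sequel
to `IdeleProjectionS.lean` (`truncIdeleBarD K S : C_{G_S}`, `finIdelePiS`), `GalLayerSystemSES.lean` (`ideleBarD K = J̄ ∈ C_Γ`)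
and `Algebra/Homology/DiscreteRepInflationQuotient.lean` (`inflQuotFunctor`).  Definitions with bodies and theorems; NO
named fact, no `sorry`, no instance, no notation; number fields in `Type`.

THE POINT (plan `D3-SCOPING-w6g10.md` §6, F2a′).  For `X : C_{G_S}` and `f : X ⟶ truncIdeleBarD K S`, the composite
`f♯ := (inflation of f) ≫ (I_S ⊆ J̄) : Inf X ⟶ J̄` is a morphism of `C_Γ = DiscreteRepCat ℤ Γ_K`; door-c6's readout
`HomDual.readout ρ n hM (ideleProjection K v) f♯` and all of its (R1)/(R2)/naturality lemmas then apply VERBATIM, its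
projections at the finite places off `S` vanish, and `f ↦ f♯` is injective — so the `S`-readout needs no new theory.

## What is formalised (`K : Type` a number field, `S : Finset (HeightOneSpectrum (𝓞 K))`, `N_S = ramificationSubgroup K ↑S`)

* `inflKS K S := inflQuotFunctor ℤ N_S : DiscreteRepCat ℤ G_S ⥤ DiscreteRepCat ℤ Γ_K`.
* **`sharp K S f : (inflKS K S).obj X ⟶ ideleBarD K`** (`f♯`), `sharp_hom_apply` (its value at `x` is `(f x : J̄)`),
  `sharp_mem_truncIdeleBar` (values in `I_S`), **`sharp_injective`**, `finIdelePi_sharp_of_not_mem` (`π_v ∘ f♯ = 0` for finite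
  `v ∉ S`), `finIdelePi_sharp` / `archIdelePi_sharp` (`π_v ∘ f♯ = π_v^S ∘ f`).

Written for lane «PT-Ш-S-TC» (brick D4b) of crux `GoodLatticeBDPValue` (cell bsd-eis, item 19032), seat bsd-line-x1-p1-w6
gen 10.  HONEST FRAMING: bookkeeping; no arithmetic statement and no case of BSD is proved here.

## References
* D. Harari, *Galois Cohomology and Class Field Theory*, Universitext, Springer (2020), Prop. 17.26 (proof), §4.3 Remark 4.24.
  [Harari2020]
* J. S. Milne, *Arithmetic Duality Theorems*, 2nd ed. (2006), I Lemma 4.13 (proof). [MilneADT2006]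
-/

noncomputable section

open NumberField IsDedekindDomain CategoryTheory
open Field (absoluteGaloisGroup)
open Literature.NumberTheory.Automorphic Literature.Algebra.Homology
open scoped Classical

namespace Literature.NumberTheory.GaloisRepresentations

namespace IdeleClassBar

variable (K : Type) [Field K] [NumberField K] (S : Finset (HeightOneSpectrum (𝓞 K)))

/-- **Inflation `C_{G_S} ⥤ C_{Γ_K}`** along `Γ_K ↠ G_S = Γ_K ⧸ N_S`. [cite: Harari2020, §4.3 Remark 4.24] -/
abbrev inflKS : DiscreteRepCat ℤ (GaloisGroupUnramifiedOutside K (↑S : Set (HeightOneSpectrum (𝓞 K)))) ⥤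
    DiscreteRepCat ℤ (absoluteGaloisGroup K) :=
  DiscreteRep.inflQuotFunctor ℤ (ramificationSubgroup K (↑S : Set (HeightOneSpectrum (𝓞 K))))

variable {K S}
variable {X : DiscreteRepCat ℤ (GaloisGroupUnramifiedOutside K (↑S : Set (HeightOneSpectrum (𝓞 K))))}

/-- The vector map of `f♯`: `x ↦ (f x : J̄)`. [cite: Harari2020, Prop. 17.26 (proof)] -/
def sharpAddHom (f : X ⟶ truncIdeleBarD K S) : X.obj.V →+ (ideleData K).toSystem.limit :=
  AddMonoidHom.mk' (fun x => Subtype.val (f.hom.hom x)) fun x y => by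
    rw [map_add]
    rfl

/-- Formula. [cite: Harari2020, Prop. 17.26 (proof)] -/
theorem sharpAddHom_apply (f : X ⟶ truncIdeleBarD K S) (x : X.obj.V) :
    sharpAddHom f x = Subtype.val (f.hom.hom x) := rfl

/-- The values of `f♯` lie in `I_S`. [cite: Harari2020, Prop. 17.26 (proof)] -/
theorem sharpAddHom_mem (f : X ⟶ truncIdeleBarD K S) (x : X.obj.V) : sharpAddHom f x ∈ truncIdeleBar K S :=
  (f.hom.hom x).2

/-- Equivariance of the vector map: `f♯ (σ • x) = σ • f♯ x` (`σ ∈ Γ_K` acting on `X` through `G_S`).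
[cite: Harari2020, Prop. 17.26 (proof)] -/
theorem sharpAddHom_rep (f : X ⟶ truncIdeleBarD K S) (σ : absoluteGaloisGroup K) (x : X.obj.V) :
    sharpAddHom f (X.obj.ρ (QuotientGroup.mk σ) x) = (ideleData K).toSystem.rep σ (sharpAddHom f x) := by
  rw [sharpAddHom_apply, sharpAddHom_apply]
  exact congrArg Subtype.val (Rep.hom_comm_apply f.hom (QuotientGroup.mk σ) x)

variable (K S) in
/-- **`f♯ : Inf X ⟶ J̄`**, the inflation of `f : X ⟶ I_S` followed by `I_S ⊆ J̄`, a morphism of `C_{Γ_K}`.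
[cite: Harari2020, Prop. 17.26 (proof)] [cite: MilneADT2006, I Lemma 4.13 (proof)] -/
def sharp (f : X ⟶ truncIdeleBarD K S) : (inflKS K S).obj X ⟶ ideleBarD K :=
  letI : Module ℤ X.obj.V := X.obj.hV2
  letI : Module ℤ ((DiscreteRep.ι ℤ (GaloisGroupUnramifiedOutside K (↑S : Set (HeightOneSpectrum (𝓞 K))))).obj X).V :=
    ((DiscreteRep.ι ℤ (GaloisGroupUnramifiedOutside K (↑S : Set (HeightOneSpectrum (𝓞 K))))).obj X).hV2
  ObjectProperty.homMk (Rep.ofHom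
    ⟨{ toFun := sharpAddHom f
       map_add' := fun x y => map_add _ x y
       map_smul' := fun c x => by
         have h := map_intCast_smul (sharpAddHom f) ℤ ℤ c x
         rw [RingHom.id_apply]
         exact h },
      fun σ => LinearMap.ext fun x => sharpAddHom_rep f σ x⟩)

/-- Formula: `f♯ x = (f x : J̄)`. [cite: Harari2020, Prop. 17.26 (proof)] -/
theorem sharp_hom_apply (f : X ⟶ truncIdeleBarD K S) (x : X.obj.V) :
    (sharp K S f).hom.hom x = Subtype.val (f.hom.hom x) := rfl

/-- The values of `f♯` lie in `I_S`. [cite: Harari2020, Prop. 17.26 (proof)] -/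
theorem sharp_mem_truncIdeleBar (f : X ⟶ truncIdeleBarD K S) (x : X.obj.V) :
    (sharp K S f).hom.hom x ∈ truncIdeleBar K S := by
  rw [sharp_hom_apply]; exact (f.hom.hom x).2

/-- **`f ↦ f♯` is injective** (the inclusion `I_S ⊆ J̄` is injective and inflation is the identity on vectors).
[cite: Harari2020, Prop. 17.26 (proof)] -/
theorem sharp_injective : Function.Injective (sharp K S (X := X)) := fun f g h => by
  apply ObjectProperty.hom_ext
  apply Rep.hom_ext
  refine DFunLike.ext _ _ fun x => ?_
  have hx := congrArg (fun e => e.hom.hom x) h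
  rw [sharp_hom_apply, sharp_hom_apply] at hx
  exact Subtype.ext hx

/-- **`π_v ∘ f♯ = π_v^S ∘ f` at a finite place.** [cite: Harari2020, Prop. 17.26 (proof)] -/
theorem finIdelePi_sharp (f : X ⟶ truncIdeleBarD K S) (v : HeightOneSpectrum (𝓞 K)) (x : X.obj.V) :
    IdeleReadout.finIdelePi v ((sharp K S f).hom.hom x) = IdeleReadout.finIdelePiS K S v (f.hom.hom x) := rfl

/-- **`π_v ∘ f♯ = 0` at a finite place `v ∉ S`.** [cite: Harari2020, Lemma 15.39, Prop. 17.26 (proof)] -/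
theorem finIdelePi_sharp_of_not_mem (f : X ⟶ truncIdeleBarD K S) {v : HeightOneSpectrum (𝓞 K)} (hv : v ∉ S)
    (x : X.obj.V) : IdeleReadout.finIdelePi v ((sharp K S f).hom.hom x) = 0 := by
  rw [finIdelePi_sharp]
  exact IdeleReadout.finIdelePiS_eq_zero_of_not_mem K S v hv _

/-- **`π_v ∘ f♯ = π_v^S ∘ f` at an infinite place.** [cite: Harari2020, Prop. 17.26 (proof)] -/
theorem archIdelePi_sharp (f : X ⟶ truncIdeleBarD K S) (v : InfinitePlace K) (x : X.obj.V) :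
    IdeleReadout.archIdelePi v ((sharp K S f).hom.hom x) = IdeleReadout.archIdelePiS K S v (f.hom.hom x) := rfl

end IdeleClassBar

end Literature.NumberTheory.GaloisRepresentations

end
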